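import Literature.Geometry.Riemannian.CanonicalNeighbourhoods
import Literature.Geometry.Riemannian.RicciFlowScaling
import HarnessLib

/-!
# Arc length, Riemannian distance and geodesic balls under constant rescaling `g ↦ c • g`
(topic `Geometry/Riemannian`)

Companion to `RicciFlowScaling.lean` (`PseudoRiemannianMetric.constSmul`) and
`MetricTraceScaling.lean`: for a Riemannian `g` and a constant `c > 0`,
* `length_constSmul`: `L_{c g}(γ) = √c · L_g(γ)` (O'Neill 1983, Ch. 5, Def. 11: `|v|_{c g} = √c |v|_g`);
* `edist_constSmul`: `d_{c g}(x, y) = √c · d_g(x, y)` (Def. 15, the infimum of lengths) — Topping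
  2006, §1.2.3: "it is clear that `g/λ` is a Ricci flow … scaling distances by a factor
  `λ^{-1/2}`" — and its total form `riemEDist_constSmul`;
* `ball_constSmul`: `B_{c g}(x, √c r) = B_g(x, r)` (radii in `ℝ≥0∞`, and `ball_constSmul_ofReal`
  for real radii).
These are the metric-space identities behind the parabolic rescalings of the Ricci flow with
surgery (Chen–Zhu 2006, §§3–5: the balls `B_t(x, σ)`, `σ < C₁ R^{-1/2}`, of the canonical
neighbourhood assumption are scale-covariant), recorded for the normalisation "we may assume
`T₀ > 1`" (§5, p. 26).

## References

* B. O'Neill, *Semi-Riemannian geometry* (1983), Ch. 5, Def. 11 (p. 131), Def. 15 (p. 134).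
  [ONeill1983]
* P. Topping, *Lectures on the Ricci flow*, LMS Lecture Note Series 325 (2006), §1.2.3.
  [Topping2006]
-/

noncomputable section

open Bundle Set Filter Manifold MeasureTheory
open scoped Manifold ContDiff Topology ENNReal NNReal

namespace Literature.Geometry.Riemannian

open Literature.Geometry.Lorentzian (PseudoRiemannianMetric)
open Literature.Geometry.Lorentzian.PseudoRiemannianMetric

variable {E : Type*} [NormedAddCommGroup E] [NormedSpace ℝ E] {H : Type*} [TopologicalSpace H]
  {I : ModelWithCorners ℝ E H} {M : Type*} [TopologicalSpace M] [ChartedSpace H M]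
  [IsManifold I ∞ M] {n : ℕ∞ω} [FiniteDimensional ℝ E]
  {g : PseudoRiemannianMetric I n E (TangentSpace I : M → Type _)}

/-! ### Arc length -/

/-- **Arc length under rescaling**: `L_{c g}(γ|[a,b]) = √c · L_g(γ|[a,b])`, since
`|v|_{c g} = (c g(v,v))^{1/2} = √c |v|_g` (O'Neill 1983, Ch. 5, Def. 11).
[cite: ONeill1983, Ch. 5, Def. 11 (p. 131)] -/
theorem _root_.Literature.Geometry.Lorentzian.PseudoRiemannianMetric.length_constSmul
    (hg : g.IsRiemannian) {c : ℝ} (hc : 0 < c) (γ : ℝ → M) (a b : ℝ) :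
    (g.constSmul c hc.ne').length (hg.constSmul hc) γ a b =
      ENNReal.ofReal (Real.sqrt c) * g.length hg γ a b := by
  rw [length_eq_lintegral, length_eq_lintegral, ← lintegral_const_mul' _ _ ENNReal.ofReal_ne_top]
  refine lintegral_congr fun t ↦ ?_
  rw [constSmul_apply, Real.sqrt_mul hc.le, ENNReal.ofReal_mul (Real.sqrt_nonneg _)]

/-! ### Riemannian distance -/

/-- Congruence of the distance in the metric (the proof argument is irrelevant). [folklore] -/
theorem _root_.Literature.Geometry.Lorentzian.PseudoRiemannianMetric.edist_congr
    {g₁ g₂ : PseudoRiemannianMetric I n E (TangentSpace I : M → Type _)} (h : g₁ = g₂)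
    (h₁ : g₁.IsRiemannian) (h₂ : g₂.IsRiemannian) (x y : M) :
    g₁.edist h₁ x y = g₂.edist h₂ x y := by
  subst h
  rfl

/-- One half of `edist_constSmul`: `d_{c g} ≤ √c · d_g` (compare with the `c g`-length of
almost minimising curves for `g`). [cite: ONeill1983, Ch. 5, Def. 15 (p. 134)] -/
theorem _root_.Literature.Geometry.Lorentzian.PseudoRiemannianMetric.edist_constSmul_le
    (hg : g.IsRiemannian) {c : ℝ} (hc : 0 < c) (x y : M) :
    (g.constSmul c hc.ne').edist (hg.constSmul hc) x y ≤
      ENNReal.ofReal (Real.sqrt c) * g.edist hg x y := by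
  have hk0 : ENNReal.ofReal (Real.sqrt c) ≠ 0 := by
    simpa [ENNReal.ofReal_eq_zero, not_le] using Real.sqrt_pos.mpr hc
  have hktop : ENNReal.ofReal (Real.sqrt c) ≠ ⊤ := ENNReal.ofReal_ne_top
  rw [mul_comm, ← ENNReal.div_le_iff hk0 hktop]
  refine le_of_forall_gt_imp_ge_of_dense fun r hr ↦ ?_
  -- an almost minimising `C¹` curve for `g`
  letI := g.riemannianBundle hg
  obtain ⟨γ, hγ0, hγ1, hγs, hlen⟩ := exists_lt_of_riemannianEDist_lt (I := I) (x := x) (y := y) hr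
  have hlen' : g.length hg γ 0 1 < r := hlen
  refine ENNReal.div_le_of_le_mul ?_
  calc (g.constSmul c hc.ne').edist (hg.constSmul hc) x y
      = (g.constSmul c hc.ne').edist (hg.constSmul hc) (γ 0) (γ 1) := by rw [hγ0, hγ1]
    _ ≤ (g.constSmul c hc.ne').length (hg.constSmul hc) γ 0 1 :=
        edist_le_length _ zero_le_one hγs
    _ = ENNReal.ofReal (Real.sqrt c) * g.length hg γ 0 1 := length_constSmul hg hc γ 0 1
    _ ≤ ENNReal.ofReal (Real.sqrt c) * r := by gcongr
    _ = r * ENNReal.ofReal (Real.sqrt c) := mul_comm _ _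

/-- **Riemannian distance under rescaling**: `d_{c g}(x, y) = √c · d_g(x, y)` for `c > 0`
(O'Neill 1983, Ch. 5, Def. 15 with Def. 11; Topping 2006, §1.2.3, "scaling distances by a
factor"). [cite: ONeill1983, Ch. 5, Def. 15 (p. 134)] [cite: Topping2006, §1.2.3] -/
theorem _root_.Literature.Geometry.Lorentzian.PseudoRiemannianMetric.edist_constSmul
    (hg : g.IsRiemannian) {c : ℝ} (hc : 0 < c) (x y : M) :
    (g.constSmul c hc.ne').edist (hg.constSmul hc) x y =
      ENNReal.ofReal (Real.sqrt c) * g.edist hg x y := by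
  refine le_antisymm (edist_constSmul_le hg hc x y) ?_
  -- the reverse inequality is the first one for `c g` and the constant `c⁻¹`
  have hc' : 0 < c⁻¹ := inv_pos.mpr hc
  have h := edist_constSmul_le (hg.constSmul hc) hc' x y
  rw [PseudoRiemannianMetric.edist_congr (g.constSmul_inv_constSmul c hc.ne') _ hg] at h
  have hk : ENNReal.ofReal (Real.sqrt c) * ENNReal.ofReal (Real.sqrt c⁻¹) = 1 := by
    rw [← ENNReal.ofReal_mul (Real.sqrt_nonneg _), ← Real.sqrt_mul hc.le, mul_inv_cancel₀ hc.ne',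
      Real.sqrt_one, ENNReal.ofReal_one]
  calc ENNReal.ofReal (Real.sqrt c) * g.edist hg x y
      ≤ ENNReal.ofReal (Real.sqrt c) *
          (ENNReal.ofReal (Real.sqrt c⁻¹) * (g.constSmul c hc.ne').edist (hg.constSmul hc) x y) := by
        gcongr
    _ = (g.constSmul c hc.ne').edist (hg.constSmul hc) x y := by rw [← mul_assoc, hk, one_mul]

/-- **Total form**: `riemEDist (c g) = √c · riemEDist g` for `c > 0` (both sides are the junk value
`0` when `g` is not Riemannian). [cite: ONeill1983, Ch. 5, Def. 15 (p. 134)] -/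
theorem _root_.Literature.Geometry.Lorentzian.PseudoRiemannianMetric.riemEDist_constSmul
    (g : PseudoRiemannianMetric I n E (TangentSpace I : M → Type _)) {c : ℝ} (hc : 0 < c)
    (x y : M) :
    (g.constSmul c hc.ne').riemEDist x y = ENNReal.ofReal (Real.sqrt c) * g.riemEDist x y := by
  by_cases hg : g.IsRiemannian
  · rw [riemEDist_eq hg, riemEDist_eq (hg.constSmul hc), edist_constSmul hg hc]
  · have hg' : ¬ (g.constSmul c hc.ne').IsRiemannian := (isRiemannian_constSmul_iff hc).not.mpr hg
    simp [PseudoRiemannianMetric.riemEDist, hg, hg']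

/-! ### Geodesic balls -/

/-- **Geodesic balls under rescaling**: `B_{c g}(x, √c · r) = B_g(x, r)` (`c > 0`, radius
`r ∈ ℝ≥0∞`). [folklore] -/
theorem _root_.Literature.Geometry.Lorentzian.PseudoRiemannianMetric.ball_constSmul
    (g : PseudoRiemannianMetric I n E (TangentSpace I : M → Type _)) {c : ℝ} (hc : 0 < c) (x : M)
    (r : ℝ≥0∞) :
    (g.constSmul c hc.ne').ball x (ENNReal.ofReal (Real.sqrt c) * r) = g.ball x r := by
  have hk0 : ENNReal.ofReal (Real.sqrt c) ≠ 0 := by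
    simpa [ENNReal.ofReal_eq_zero, not_le] using Real.sqrt_pos.mpr hc
  ext y
  rw [PseudoRiemannianMetric.mem_ball, PseudoRiemannianMetric.mem_ball, riemEDist_constSmul g hc,
    ENNReal.mul_lt_mul_iff_right hk0 ENNReal.ofReal_ne_top]

/-- The same with real radii: `B_{c g}(x, √c σ) = B_g(x, σ)`. [folklore] -/
theorem _root_.Literature.Geometry.Lorentzian.PseudoRiemannianMetric.ball_constSmul_ofReal
    (g : PseudoRiemannianMetric I n E (TangentSpace I : M → Type _)) {c : ℝ} (hc : 0 < c) (x : M)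
    (σ : ℝ) :
    (g.constSmul c hc.ne').ball x (ENNReal.ofReal (Real.sqrt c * σ)) = g.ball x (ENNReal.ofReal σ) := by
  rw [ENNReal.ofReal_mul (Real.sqrt_nonneg _), ball_constSmul g hc]

end Literature.Geometry.Riemannian

end
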